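import Summits.QuantumFields.YangMills.Theorems.UnitScaleGibbsDressedEventSplit
import Literature.MathematicalPhysics.QuantumFieldTheory.Balaban1983to89.B12ContinuousTransportInvarianceOn
import HarnessLib

/-!
# `UnitScaleGibbsDressedEventSplitCollar` — THE INTEGRATED EVENT SPLIT WITH A COLLAR ROW: pointwise `f ≤ C·Σ_α Y_α² + Σ_b ω_b·dist₁((VU)b)² + E` on the
# small-field event integrates to `∫f ≤ C·Σ_α∫Y_α² + Σ_b ω_b·∫dist₁((VU)b)² + E + 4·μ(eventᶜ)` (the last lines of the re-lined `stub_linTest` of LINE 28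
# «GrossTransfer», crux `UnitScaleTilt.HistoryTailL` stmt-QuantumFields-19936 ∕ `MeanDeviationL` stmt-QuantumFields-23083)

Cell `ym3-torus` (YM ladder rung R3 = continuum SU(2) Yang–Mills on T³ — a RUNG, NOT the Clay problem: not d = 4, not infinite volume, not a mass gap),
width seat `ym-ust-19936-w2` (gen 15), pen of record of `stub_linTest`.  ✓`UnitScaleGibbsDressedEventSplit.integral_dist1_sq_iter_le_of_pointwise` (w8 g9)
integrates a pointwise bound with a CONSTANT error `E`; the re-lined stub (v3∕v3.1, 23083 evidence #6∕#7) carries in addition the COLLAR ROW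
`Σ_b ω_b·dist₁((VU) b)²` (`VU = U^{axialGauge U lo hi}`, weights `ω_b ≥ 0` produced by ✓`UnitScaleGibbsCollarPairingSecondMoment`), cashed downstream by the
perimeter law of thin rectangles (✓`UnitScaleGibbsThinRectanglePerimeterGibbs`).  THIS FILE adds that row to the integration: §1 the dressed bond deviation
`U ↦ dist₁((VU) b)²` is measurable and in `[0,4]`; §2 ★`integral_le_of_pointwise_dressed_collar` (any probability measure, any event); §3 ★★
`integral_dist1_sq_iter_le_of_pointwise_collar` in the tokens of `stub_linTest` v3.1.
HONEST FRAMING.  Measure-theory bookkeeping; `--supports` helper; proves no stub, crux, rung or summit statement; `stub_linTest`, «ShallowFluxSecondMomentL»,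
(Q), K1, `MeanDeviationL`, `HistoryTailL` are NOT proved; the Yang–Mills mass gap is NOT proved.
References: L. Gross, *Convergence of U(1)₃ lattice gauge theory to its continuum limit*, Comm. Math. Phys. 92 (1983), Thm 2.2 (integration by parts on the
gauge group) [GrossCMP1983]; [Balaban1985Averaging] (9),(19) pp. 19–21 (continuity bookkeeping of plaquette∕bond variables).
-/

noncomputable section

open MeasureTheory Filter Topology
open scoped BigOperators
open Literature.MathematicalPhysics.QuantumFieldTheory.Balaban1983to89
open Literature.MathematicalPhysics.QuantumFieldTheory.Balaban1983to89.T3ContinuumYM3Torus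
open Literature.MathematicalPhysics.QuantumFieldTheory.Balaban1983to89.T3UnitScaleTilt
open Literature.MathematicalPhysics.QuantumFieldTheory.Balaban1983to89.T3UnitLawDensityEML (ℰp measurableE_ℰp)
open Literature.MathematicalPhysics.QuantumFieldTheory.Balaban1983to89.T4AxialGaugeSmallField (axialGauge boxPlaqs castSite)
open Literature.MathematicalPhysics.QuantumFieldTheory.Balaban1983to89.T4AxialGaugeFixing (measurableSet_plaqSmallOn)
open Literature.MathematicalPhysics.QuantumLattice (fundamentalRep continuous_fundamentalRep)
open Summit.QuantumFields.YangMills.Theorems.UnitScaleGibbsMGFSecondMoment (integrable_of_abs_le)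
open Summit.QuantumFields.YangMills.Theorems.UnitScaleGibbsActionDerivativeSlotCalculus (actionDeriv continuous_actionDeriv)
open Summit.QuantumFields.YangMills.Theorems.UnitScaleGibbsAxialGaugeDocking (measurable_gaugeAct_axialGauge)
open Summit.QuantumFields.YangMills.Theorems.UnitScaleGibbsDressedEventSplit (integral_le_of_onEvent_bound measurable_bounded_actionDeriv_dressed)

namespace Summit.QuantumFields.YangMills.Theorems.UnitScaleGibbsDressedEventSplitCollar

/-! ## §1 The dressed bond deviation is measurable and bounded -/

section SpecialUnitary

variable {N : ℕ} [NeZero N] {P : Params}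

/-- `U ↦ dist₁((U^{axialGauge U lo hi}) b)²` is measurable, nonnegative and at most `4`. [cite: Balaban1985Averaging, (19) p.21] -/
theorem measurable_dist1_sq_dressed_bond (lo hi : Fin P.d → ℤ) (b : PBond P 0) :
    Measurable (fun U : GaugeField P 0 (Matrix.specialUnitaryGroup (Fin N) ℂ) =>
        (GaugeGroup.dist1 (GaugeField.gaugeAct (axialGauge U lo hi) U b)) ^ 2) ∧
      ∀ U : GaugeField P 0 (Matrix.specialUnitaryGroup (Fin N) ℂ),
        0 ≤ (GaugeGroup.dist1 (GaugeField.gaugeAct (axialGauge U lo hi) U b)) ^ 2 ∧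
          (GaugeGroup.dist1 (GaugeField.gaugeAct (axialGauge U lo hi) U b)) ^ 2 ≤ 4 := by
  haveI : SecondCountableTopology (Matrix.specialUnitaryGroup (Fin N) ℂ) := by
    haveI := secondCountableTopology_matrix (n := Fin N)
    exact Topology.IsEmbedding.subtypeVal.secondCountableTopology
  haveI : OpensMeasurableSpace (GaugeField P 0 (Matrix.specialUnitaryGroup (Fin N) ℂ)) :=
    inferInstanceAs (OpensMeasurableSpace (PBond P 0 → Matrix.specialUnitaryGroup (Fin N) ℂ))
  have hc : Continuous fun W : GaugeField P 0 (Matrix.specialUnitaryGroup (Fin N) ℂ) => (GaugeGroup.dist1 (W b)) ^ 2 :=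
    ((B12ContinuousTransportInvarianceOn.continuous_dist1_SU (N := N)).comp (continuous_apply b)).pow 2
  refine ⟨hc.measurable.comp (measurable_gaugeAct_axialGauge lo hi), fun U => ⟨sq_nonneg _, ?_⟩⟩
  have h2 := T4PairDerivBridge.dist1_le_two_specialUnitaryGroup (GaugeField.gaugeAct (axialGauge U lo hi) U b)
  have h0 := GaugeGroup.dist1_nonneg (GaugeField.gaugeAct (axialGauge U lo hi) U b)
  nlinarith

/-! ## §2 The integrated event split with a collar row -/

/-- ★ **INTEGRATED EVENT SPLIT, DRESSED ROWS + COLLAR ROW** (`SU(N)`, any probability measure, any measurable event `G`, `0 ≤ f ≤ M`, weights `ω ≥ 0`):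
`f ≤ C·Σ_α Y_α² + Σ_b ω_b·dist₁((VU)b)² + E` on `G` ⟹ `∫f ≤ C·Σ_α∫Y_α² + Σ_b ω_b·∫dist₁((VU)b)² + E + M·μ(Gᶜ)`. [cite: GrossCMP1983, Thm 2.2] -/
theorem integral_le_of_pointwise_dressed_collar {ι : Type*} [Fintype ι]
    (μ : Measure (GaugeField P 0 (Matrix.specialUnitaryGroup (Fin N) ℂ))) [IsProbabilityMeasure μ]
    {f : GaugeField P 0 (Matrix.specialUnitaryGroup (Fin N) ℂ) → ℝ} {M : ℝ} (hf0 : ∀ U, 0 ≤ f U) (hfM : ∀ U, f U ≤ M)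
    {G : Set (GaugeField P 0 (Matrix.specialUnitaryGroup (Fin N) ℂ))} (hG : MeasurableSet G)
    (lo hi : Fin P.d → ℤ) (u : ι → PBond P 0 → Matrix (Fin N) (Fin N) ℂ) {C E : ℝ} (hC : 0 ≤ C) (hE : 0 ≤ E)
    (ω : PBond P 0 → ℝ) (hω : ∀ b, 0 ≤ ω b)
    (hpt : ∀ U ∈ G, f U ≤ C * ∑ α, (actionDeriv (fundamentalRep (Fin N)) (u α) (GaugeField.gaugeAct (axialGauge U lo hi) U)) ^ 2
      + ∑ b, ω b * (GaugeGroup.dist1 (GaugeField.gaugeAct (axialGauge U lo hi) U b)) ^ 2 + E) :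
    ∫ U, f U ∂μ ≤
      C * ∑ α, ∫ U, (actionDeriv (fundamentalRep (Fin N)) (u α) (GaugeField.gaugeAct (axialGauge U lo hi) U)) ^ 2 ∂μ
        + ∑ b, ω b * ∫ U, (GaugeGroup.dist1 (GaugeField.gaugeAct (axialGauge U lo hi) U b)) ^ 2 ∂μ
        + E + M * μ.real Gᶜ := by
  have hrow : ∀ α, Integrable (fun U => (actionDeriv (fundamentalRep (Fin N)) (u α)
      (GaugeField.gaugeAct (axialGauge U lo hi) U)) ^ 2) μ := fun α => by
    obtain ⟨hm, B, hB0, hB⟩ := measurable_bounded_actionDeriv_dressed (P := P) (u α) lo hi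
    refine integrable_of_abs_le μ (hm.pow_const 2) (C := B ^ 2) fun U => ?_
    rw [abs_pow]
    exact pow_le_pow_left₀ (abs_nonneg _) (hB U) 2
  have hbond : ∀ b, Integrable (fun U => (GaugeGroup.dist1 (GaugeField.gaugeAct (axialGauge U lo hi) U b)) ^ 2) μ := fun b => by
    obtain ⟨hm, hbd⟩ := measurable_dist1_sq_dressed_bond (P := P) (N := N) lo hi b
    exact integrable_of_abs_le μ hm (C := 4) fun U => by rw [abs_of_nonneg (hbd U).1]; exact (hbd U).2
  set g : GaugeField P 0 (Matrix.specialUnitaryGroup (Fin N) ℂ) → ℝ := fun U =>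
    C * ∑ α, (actionDeriv (fundamentalRep (Fin N)) (u α) (GaugeField.gaugeAct (axialGauge U lo hi) U)) ^ 2
      + ∑ b, ω b * (GaugeGroup.dist1 (GaugeField.gaugeAct (axialGauge U lo hi) U b)) ^ 2 + E with hg
  have hg0 : ∀ U, 0 ≤ g U := fun U =>
    add_nonneg (add_nonneg (mul_nonneg hC (Finset.sum_nonneg fun α _ => sq_nonneg _))
      (Finset.sum_nonneg fun b _ => mul_nonneg (hω b) (sq_nonneg _))) hE
  have hsum : Integrable (fun U => ∑ α, (actionDeriv (fundamentalRep (Fin N)) (u α)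
      (GaugeField.gaugeAct (axialGauge U lo hi) U)) ^ 2) μ := integrable_finsetSum _ fun α _ => hrow α
  have hsumb : Integrable (fun U => ∑ b, ω b * (GaugeGroup.dist1 (GaugeField.gaugeAct (axialGauge U lo hi) U b)) ^ 2) μ :=
    integrable_finsetSum _ fun b _ => (hbond b).const_mul (ω b)
  have hgi : Integrable g μ := ((hsum.const_mul C).add hsumb).add (integrable_const E)
  have h := integral_le_of_onEvent_bound μ hf0 hfM hG hg0 hgi hpt
  have hgint : ∫ U, g U ∂μ =
      C * ∑ α, ∫ U, (actionDeriv (fundamentalRep (Fin N)) (u α) (GaugeField.gaugeAct (axialGauge U lo hi) U)) ^ 2 ∂μ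
        + ∑ b, ω b * ∫ U, (GaugeGroup.dist1 (GaugeField.gaugeAct (axialGauge U lo hi) U b)) ^ 2 ∂μ + E := by
    have e1 : ∫ U, g U ∂μ = ∫ U, (C * ∑ α, (actionDeriv (fundamentalRep (Fin N)) (u α) (GaugeField.gaugeAct (axialGauge U lo hi) U)) ^ 2
        + ∑ b, ω b * (GaugeGroup.dist1 (GaugeField.gaugeAct (axialGauge U lo hi) U b)) ^ 2) ∂μ + ∫ U, E ∂μ := by
      rw [hg]; exact integral_add ((hsum.const_mul C).add hsumb) (integrable_const E)
    have e2 : ∫ U, (C * ∑ α, (actionDeriv (fundamentalRep (Fin N)) (u α) (GaugeField.gaugeAct (axialGauge U lo hi) U)) ^ 2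
        + ∑ b, ω b * (GaugeGroup.dist1 (GaugeField.gaugeAct (axialGauge U lo hi) U b)) ^ 2) ∂μ =
        ∫ U, C * ∑ α, (actionDeriv (fundamentalRep (Fin N)) (u α) (GaugeField.gaugeAct (axialGauge U lo hi) U)) ^ 2 ∂μ
          + ∫ U, ∑ b, ω b * (GaugeGroup.dist1 (GaugeField.gaugeAct (axialGauge U lo hi) U b)) ^ 2 ∂μ :=
      integral_add (hsum.const_mul C) hsumb
    rw [e1, e2, integral_const_mul, integral_finsetSum _ (fun α _ => hrow α), integral_finsetSum _ (fun b _ => (hbond b).const_mul (ω b)),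
      integral_const, smul_eq_mul, probReal_univ, one_mul]
    simp only [integral_const_mul]
  linarith [h, hgint]

end SpecialUnitary

/-! ## §3 In the currency of `stub_linTest` v3.1 -/

section Stub

/-- ★★ **THE LAST LINES OF THE RE-LINED `stub_linTest` FROM A POINTWISE BOUND.**  For `γ ≥ 0`, every `K, j, a`, box `(lo, hi)`, threshold `θ`, test fields
`u : Fin 3 → …`, weights `ω ≥ 0` and constants `C, E ≥ 0`: IF on `PlaqSmallOn (boxPlaqs lo hi) θ U` POINTWISE
`dist₁(Ū^j(∂a))² ≤ C·Σ_α Y_α(U)² + Σ_b ω_b·dist₁((VU)b)² + E` (`Y_α(U) = actionDeriv ρ (u α) (VU)`, `VU = U^{axialGauge U lo hi}`), THEN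
`∫dist₁(Ū^j(∂a))² ≤ C·Σ_α∫Y_α² + E + 4·gibbsK{¬PlaqSmallOn} + Σ_b ω_b·∫dist₁((VU)b)²` — the conclusion of `stub_linTest` v3.1 in its token order. [cite: GrossCMP1983, Thm 2.2] -/
theorem integral_dist1_sq_iter_le_of_pointwise_collar (F : T3Family) {γ : ℝ} (hγ : 0 ≤ γ) (K j : ℕ) (a : Plaq (F.P K) j)
    (lo hi : Fin (F.P K).d → ℤ) (θ : ℝ) (u : Fin 3 → PBond (F.P K) 0 → Matrix (Fin 2) (Fin 2) ℂ) (ω : PBond (F.P K) 0 → ℝ) (hω : ∀ b, 0 ≤ ω b)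
    {C E : ℝ} (hC : 0 ≤ C) (hE : 0 ≤ E)
    (hpt : ∀ U : GaugeField (F.P K) 0 (Matrix.specialUnitaryGroup (Fin 2) ℂ), PlaqSmallOn (boxPlaqs lo hi) θ U →
      (GaugeGroup.dist1 (GaugeField.plaqHol
          (Averaging.iter (fun i' => BlockAveraging.blockAvg (P := F.P K) (j := i') ℰp) j U) a)) ^ 2
        ≤ C * ∑ α, (actionDeriv (fundamentalRep (Fin 2)) (u α) (GaugeField.gaugeAct (axialGauge U lo hi) U)) ^ 2
          + ∑ b, ω b * (GaugeGroup.dist1 (GaugeField.gaugeAct (axialGauge U lo hi) U b)) ^ 2 + E) :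
    ∫ U, (GaugeGroup.dist1 (GaugeField.plaqHol
        (Averaging.iter (fun i' => BlockAveraging.blockAvg (P := F.P K) (j := i') ℰp) j U) a)) ^ 2 ∂(gibbsK F ℰp γ K)
      ≤ C * ∑ α, ∫ U, (actionDeriv (fundamentalRep (Fin 2)) (u α) (GaugeField.gaugeAct (axialGauge U lo hi) U)) ^ 2 ∂(gibbsK F ℰp γ K)
        + E
        + 4 * (gibbsK F ℰp γ K).real {U | ¬ PlaqSmallOn (boxPlaqs lo hi) θ U}
        + ∑ b, ω b * ∫ U, (GaugeGroup.dist1 (GaugeField.gaugeAct (axialGauge U lo hi) U b)) ^ 2 ∂(gibbsK F ℰp γ K) := by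
  haveI := isProbabilityMeasure_gibbsK F ℰp hγ K
  have hG : MeasurableSet {U : GaugeField (F.P K) 0 (Matrix.specialUnitaryGroup (Fin 2) ℂ) | PlaqSmallOn (boxPlaqs lo hi) θ U} :=
    measurableSet_plaqSmallOn _ _
  have hf0 : ∀ U : GaugeField (F.P K) 0 (Matrix.specialUnitaryGroup (Fin 2) ℂ), 0 ≤ (GaugeGroup.dist1 (GaugeField.plaqHol
      (Averaging.iter (fun i' => BlockAveraging.blockAvg (P := F.P K) (j := i') ℰp) j U) a)) ^ 2 := fun U => sq_nonneg _
  have hf4 : ∀ U : GaugeField (F.P K) 0 (Matrix.specialUnitaryGroup (Fin 2) ℂ), (GaugeGroup.dist1 (GaugeField.plaqHol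
      (Averaging.iter (fun i' => BlockAveraging.blockAvg (P := F.P K) (j := i') ℰp) j U) a)) ^ 2 ≤ 4 := fun U => by
    have h2 := T4PairDerivBridge.dist1_le_two_specialUnitaryGroup (GaugeField.plaqHol
      (Averaging.iter (fun i' => BlockAveraging.blockAvg (P := F.P K) (j := i') ℰp) j U) a)
    have h0 := GaugeGroup.dist1_nonneg (GaugeField.plaqHol
      (Averaging.iter (fun i' => BlockAveraging.blockAvg (P := F.P K) (j := i') ℰp) j U) a)
    nlinarith
  have h := integral_le_of_pointwise_dressed_collar (gibbsK F ℰp γ K) hf0 hf4 hG lo hi u hC hE ω hω (fun U hU => hpt U hU)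
  have hc : {U : GaugeField (F.P K) 0 (Matrix.specialUnitaryGroup (Fin 2) ℂ) | PlaqSmallOn (boxPlaqs lo hi) θ U}ᶜ =
      {U | ¬ PlaqSmallOn (boxPlaqs lo hi) θ U} := rfl
  rw [hc] at h
  linarith

end Stub

end Summit.QuantumFields.YangMills.Theorems.UnitScaleGibbsDressedEventSplitCollar

end
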